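import Summits.QuantumFields.QCD.Theorems.QuarksAsStableActionStableActionBridgeGaugeKernelBounds

/-!
# Regularity of the scalar kernel of Smit's QCD transfer matrix on `SU(3)^{links} × J`
(crux `HeatSlicedQuarks.RobustYangMillsHandover`, item stmt-QuantumFields-8892, line `pin-the-infimum`;
registered sub-goal `qcdTransferKernel_regular` of the lead's spectral infrastructure, wave 1)

The lead realises Smit's transfer matrix `T̂ = T̂_F^{1/2} T̂_U T̂_F^{1/2}` (Smit, *Introduction to Quantum
Fields on a Lattice*, §6.5 (6.87)) as a scalar integral operator on `L²(X × J, sliceHaar × count)`,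
`X = SU(3)^{Edge 3 S}` the (compact, second countable) slice configuration space and `J` a finite
measurable index type with measurable singletons in bijection `e` with the Fock index
`Finset (SliceFermiIdx N_f S)`.  Its kernel is

  `k((U, s), (U', t)) = K_β(U, U') · (R(U) R(U'))_{e⁻¹ s, e⁻¹ t}`,

with `K_β = gaugeSliceKernel β` the real, symmetric, jointly continuous Wilson gauge kernel and
`R : X → Matrix` a continuous Hermitian-matrix-valued map (the square root of `T̂_F`).  This file proves
the three regularity facts the abstract Hermitian-kernel package consumes:

* `uncurry k` is strongly measurable on `(X × J) × (X × J)`: after regrouping the variables as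
  `(X × X) × (J × J)` it is, for each of the countably many index pairs `(s, t)`, continuous in `(U, U')`
  (`measurable_from_prod_countable_left`);
* a uniform bound `‖k‖ ≤ C`: a single entry is dominated by the entry sum
  `∑_{s,t} ‖K_β(U,U') (R(U)R(U'))_{st}‖`, a continuous function on the compact `X × X`;
* Hermitian symmetry `k(p, q) = conj k(q, p)`, from `K_β(U, U') = K_β(U', U)` (real kernel) and
  `(R(U') R(U))ᴴ = R(U)ᴴ R(U')ᴴ = R(U) R(U')` for Hermitian `R`.

References: J. Smit, *Introduction to Quantum Fields on a Lattice*, §6.5 (6.87) [Smit2023];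
M. Lüscher, Commun. Math. Phys. 54 (1977) 283 [Luscher1977, pp. 283–292].  Pure theorem file.
-/

noncomputable section

namespace Summit.QuantumFields.QCD.Cruxes.RobustYangMillsHandover.PinTheInfimum

open scoped ComplexConjugate
open MeasureTheory Matrix Literature.MathematicalPhysics.QuantumFieldTheory
  Literature.MathematicalPhysics.QuantumLattice
open Summit.QuantumFields.QCD.Cruxes.StableActionBridge.Sketch

namespace TransferKernelRegular

variable {S : ℕ} [NeZero S] {ι : Type} [Fintype ι]

/-- For a continuous matrix-valued `R` and fixed indices `s, t`, the scalar
`(U, U') ↦ K_β(U, U') · (R(U) R(U'))_{st}` is jointly continuous on the product of two slices. [folklore] -/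
theorem continuous_kernel_entry (β : ℝ)
    {R : GaugeConfig 3 S (Matrix.specialUnitaryGroup (Fin 3) ℂ) → Matrix ι ι ℂ} (hR : Continuous R)
    (s t : ι) :
    Continuous fun x : GaugeConfig 3 S (Matrix.specialUnitaryGroup (Fin 3) ℂ) ×
        GaugeConfig 3 S (Matrix.specialUnitaryGroup (Fin 3) ℂ) =>
      (gaugeSliceKernel β x.1 x.2 : ℂ) * (R x.1 * R x.2) s t :=
  (Complex.continuous_ofReal.comp (continuous_gaugeSliceKernel S β)).mul
    (((hR.comp continuous_fst).matrix_mul (hR.comp continuous_snd)).matrix_elem s t)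

/-- The entry sum `(U, U') ↦ ∑_{s,t} ‖K_β(U, U') · (R(U) R(U'))_{st}‖` is continuous, hence bounded on the
compact product of two slices: there is `C` with `∑_{s,t} ‖K_β(U, U') (R(U) R(U'))_{st}‖ ≤ C`. [folklore] -/
theorem exists_bound_kernel_entry_sum (β : ℝ)
    {R : GaugeConfig 3 S (Matrix.specialUnitaryGroup (Fin 3) ℂ) → Matrix ι ι ℂ} (hR : Continuous R) :
    ∃ C : ℝ, ∀ U U' : GaugeConfig 3 S (Matrix.specialUnitaryGroup (Fin 3) ℂ),
      ∑ s, ∑ t, ‖(gaugeSliceKernel β U U' : ℂ) * (R U * R U') s t‖ ≤ C := by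
  have hc : Continuous fun x : GaugeConfig 3 S (Matrix.specialUnitaryGroup (Fin 3) ℂ) ×
      GaugeConfig 3 S (Matrix.specialUnitaryGroup (Fin 3) ℂ) =>
        ∑ s, ∑ t, ‖(gaugeSliceKernel β x.1 x.2 : ℂ) * (R x.1 * R x.2) s t‖ :=
    continuous_finsetSum _ fun s _ => continuous_finsetSum _ fun t _ =>
      (continuous_kernel_entry β hR s t).norm
  obtain ⟨C, hC⟩ := isCompact_univ.exists_bound_of_continuousOn hc.continuousOn
  exact ⟨C, fun U U' => (Real.le_norm_self _).trans (hC (U, U') (Set.mem_univ _))⟩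

end TransferKernelRegular

open TransferKernelRegular

/-- **Regularity of the scalar QCD transfer kernel** `k((U,s),(U',t)) = K_β(U,U') · (R(U)R(U'))_{e⁻¹s, e⁻¹t}`
on `(SU(3)^{links} × J)²` for a continuous Hermitian matrix field `R` (registered sub-goal
`qcdTransferKernel_regular`): (i) `uncurry k` is strongly measurable (continuous in `(U, U')` for each of
the countably many index pairs); (ii) `‖k‖ ≤ C` uniformly (entry sum continuous on the compact `X × X`);
(iii) `k(p, q) = conj k(q, p)` (`K_β` real symmetric, `(R(U')R(U))ᴴ = R(U)R(U')`).  These are the three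
inputs of the abstract bounded-Hermitian-kernel package realising Smit's `T̂ = T̂_F^{1/2} T̂_U T̂_F^{1/2}` as a
compact self-adjoint operator on `L²`. [cite: Smit2023, §6.5 (6.87)] -/
theorem qcdTransferKernel_regular : ∀ (Nf S : ℕ) [NeZero S] (β : ℝ) (J : Type) [Fintype J] [MeasurableSpace J] [MeasurableSingletonClass J] (e : Finset (SliceFermiIdx Nf S) ≃ J) (R : GaugeConfig 3 S (Matrix.specialUnitaryGroup (Fin 3) ℂ) → Matrix (Finset (SliceFermiIdx Nf S)) (Finset (SliceFermiIdx Nf S)) ℂ), Continuous R → (∀ U, (R U)ᴴ = R U) → StronglyMeasurable (Function.uncurry fun (p q : GaugeConfig 3 S (Matrix.specialUnitaryGroup (Fin 3) ℂ) × J) => (gaugeSliceKernel β p.1 q.1 : ℂ) * (R p.1 * R q.1) (e.symm p.2) (e.symm q.2)) ∧ (∃ C : ℝ, ∀ p q : GaugeConfig 3 S (Matrix.specialUnitaryGroup (Fin 3) ℂ) × J, ‖(gaugeSliceKernel β p.1 q.1 : ℂ) * (R p.1 * R q.1) (e.symm p.2) (e.symm q.2)‖ ≤ C) ∧ ∀ p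 q : GaugeConfig 3 S (Matrix.specialUnitaryGroup (Fin 3) ℂ) × J, (gaugeSliceKernel β p.1 q.1 : ℂ) * (R p.1 * R q.1) (e.symm p.2) (e.symm q.2) = (starRingEnd ℂ) ((gaugeSliceKernel β q.1 p.1 : ℂ) * (R q.1 * R p.1) (e.symm q.2) (e.symm p.2)) := by
  intro Nf S _ β J _ _ _ e R hR hH
  refine ⟨?_, ?_, ?_⟩
  · -- (i) strong measurability: regroup as `(X × X) × (J × J)`, countable second factor
    have hg : Measurable fun w : (GaugeConfig 3 S (Matrix.specialUnitaryGroup (Fin 3) ℂ) ×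
        GaugeConfig 3 S (Matrix.specialUnitaryGroup (Fin 3) ℂ)) × (J × J) =>
          (gaugeSliceKernel β w.1.1 w.1.2 : ℂ) * (R w.1.1 * R w.1.2) (e.symm w.2.1) (e.symm w.2.2) :=
      measurable_from_prod_countable_left fun st =>
        (continuous_kernel_entry β hR (e.symm st.1) (e.symm st.2)).measurable
    have hm : Measurable fun z : (GaugeConfig 3 S (Matrix.specialUnitaryGroup (Fin 3) ℂ) × J) ×
        (GaugeConfig 3 S (Matrix.specialUnitaryGroup (Fin 3) ℂ) × J) => ((z.1.1, z.2.1), (z.1.2, z.2.2)) :=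
      (measurable_fst.fst.prodMk measurable_snd.fst).prodMk (measurable_fst.snd.prodMk measurable_snd.snd)
    exact (hg.comp hm).stronglyMeasurable
  · -- (ii) uniform bound: one entry is dominated by the (continuous, hence bounded) entry sum
    obtain ⟨C, hC⟩ := exists_bound_kernel_entry_sum (ι := Finset (SliceFermiIdx Nf S)) β hR
    refine ⟨C, fun p q => le_trans ?_ (hC p.1 q.1)⟩
    calc ‖(gaugeSliceKernel β p.1 q.1 : ℂ) * (R p.1 * R q.1) (e.symm p.2) (e.symm q.2)‖
        ≤ ∑ t, ‖(gaugeSliceKernel β p.1 q.1 : ℂ) * (R p.1 * R q.1) (e.symm p.2) t‖ :=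
          Finset.single_le_sum
            (f := fun t => ‖(gaugeSliceKernel β p.1 q.1 : ℂ) * (R p.1 * R q.1) (e.symm p.2) t‖)
            (fun t _ => norm_nonneg _) (Finset.mem_univ (e.symm q.2))
      _ ≤ ∑ s, ∑ t, ‖(gaugeSliceKernel β p.1 q.1 : ℂ) * (R p.1 * R q.1) s t‖ :=
          Finset.single_le_sum
            (f := fun s => ∑ t, ‖(gaugeSliceKernel β p.1 q.1 : ℂ) * (R p.1 * R q.1) s t‖)
            (fun s _ => Finset.sum_nonneg fun t _ => norm_nonneg _) (Finset.mem_univ (e.symm p.2))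
  · -- (iii) Hermitian symmetry
    intro p q
    rw [map_mul, Complex.conj_ofReal, starRingEnd_apply, ← Matrix.conjTranspose_apply,
      Matrix.conjTranspose_mul, hH, hH, gaugeSliceKernel_symm β q.1 p.1]

end Summit.QuantumFields.QCD.Cruxes.RobustYangMillsHandover.PinTheInfimum

end
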